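import Summits.QuantumFields.BalabanUV.T4Continuum.Support.SubstrateCovariantAveraging
import Summits.QuantumFields.BalabanUV.T4Continuum.Support.SubstrateGaugeCovariance

/-!
# SUBSTRATE — GAUGE COVARIANCE OF BAŁABAN's COVARIANT BLOCK AVERAGING OF A GAUGE FIELD along a PATH contour system:
# `Q_k(U^u) = 𝒰_coarse · Q_k(U) · 𝒰_fine⁻¹` (entrywise and as `siteMul` conjugation), for every contour system whose contours are
# bond paths from the block's base point to the averaged bond (follower of `SubstrateCovariantAveraging`, the V1 half of item S-Q)

Cell `pub-balaban`, SUBSTRATE cell, seat `b2b-balaban-substrate-p1`.  Summits-side under the LEAN PLACEMENT RULE (cell library).  HONEST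
FRAMING: rung (B)+1 of the FINITE-VOLUME T⁴ programme — NOT infinite volume, NOT a mass gap, NOT Clay; spine PROVED 0∕9.  ALGEBRA OF THE
DICTIONARY ONLY: the path property of the contour system is a DISPLAYED hypothesis (`IsPathSystem`) — that the contour system OF RECORD
`CovariantBlockAveraging.contour n M` ([Balaban1984PropagatorsI] (1.7) p. 18 shape) satisfies it is plane bookkeeping in `ZMod`, left
to item S-Q; the adjoint identities of `Q_k(U)` are seat p3's (`ScalarCovariantAveragingAdjoint`).  Nothing of the audited papers asserted.
HONEST DEPENDENCY (cell line, verbatim): continuum YM on T⁴ ⇐ BetaPertH ∧ nine spine estimates (0/9 proved); BetaPertH ⇐ (D1) ∧ (D4) ∧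
CAP+tail; G-an2-4 gates asym, D1 and NE2/3/4.

WHAT.
* §1 A generic ENTRY FORMULA for two-sided site multiplication: `(siteMul v * X * siteMul w) (b, α) (i, α′) = (v b · X⟦b, i⟧ · w i) α α′`
  with `X⟦b, i⟧` the `o × o` block of `X` (`siteMul_mul_mul_siteMul_apply`, `blockOf`).
* §2 `IsPathSystem e Γ base`: every contour `Γ y j μ t` is a bond path (`SubstrateCovariantAveraging.IsBondPath`) from the block's base
  point `base y` to the source of the averaged fine bond `e⁻¹(bpt y j + t·e_μ)` — the SHAPE of (1.7)∕(1.18) («Γ_{y,x} ∪ [x, x(b)]»).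
* §3 THE GAUGE LAW: for a path contour system, the block of `Qcov n M Γ (transV e ι (U^u))` at `(b, i)` is
  `ι(u(base y)) · (block of Qcov n M Γ (transV e ι U)) · ι(u(e⁻¹ x))⁻¹` (`Qcov_blockOf_gaugeAct`), hence
  **`Qcov_transV_gaugeAct : Qcov n M Γ (transV e ι (U^u)) = siteMul (coarse multiplier) * Qcov n M Γ (transV e ι U) * siteMul (gaugeMulInv e ι u)`**
  — Bałaban's «Q_k(U^u) A^u = (Q_k(U) A)^u» ([Balaban1985BackgroundPropagators] (3.16)–(3.17) p. 393, SHAPE) for the V1 gauge field read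
  through the dictionary; and the `QcovOf` form on the tower chart.
Imports `SubstrateCovariantAveraging`, `SubstrateGaugeCovariance`; nothing existing is modified.
-/

noncomputable section

open scoped BigOperators Matrix Kronecker Matrix.Norms.L2Operator

namespace Summit.QuantumFields.BalabanUV.T4Continuum.SubstrateCovariantAveragingGauge

open Literature.MathematicalPhysics.QuantumFieldTheory.Balaban1983to89
open Literature.MathematicalPhysics.QuantumFieldTheory.Balaban1983to89.B5Prop11Plancherel (Tor unitVec fine)
open Literature.MathematicalPhysics.QuantumFieldTheory.Balaban1983to89.B5Block118 (QvOp bpt tstep up)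
open Literature.MathematicalPhysics.QuantumFieldTheory.Balaban1983to89.B5G183RateUnitTower (lev lev_neZero)
open Summit.QuantumFields.BalabanUV.T4Continuum.BlockMultiplication (siteMul siteMul_apply)
open Summit.QuantumFields.BalabanUV.T4Continuum.CovariantBlockAveraging (transport ContourSystem Qcov)
open Summit.QuantumFields.BalabanUV.T4Continuum.SubstrateBackgroundTransporters
open Summit.QuantumFields.BalabanUV.T4Continuum.SubstrateGaugeCovariance (gaugeMul gaugeMulInv gaugeMul_apply gaugeMulInv_apply)
open Summit.QuantumFields.BalabanUV.T4Continuum.SubstrateCovariantAveraging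

/-! ## §1 Blocks and the entry formula for two-sided site multiplication -/

section Blocks

variable {β γ o : Type*}

/-- [folklore] The `o × o` BLOCK of a matrix over `(β × o) × (γ × o)` at the site pair `(b, i)`. -/
def blockOf (X : Matrix (β × o) (γ × o) ℂ) (b : β) (i : γ) : Matrix o o ℂ := Matrix.of fun α α' => X (b, α) (i, α')

/-- [folklore] `blockOf` unfolded. -/
@[simp] theorem blockOf_apply (X : Matrix (β × o) (γ × o) ℂ) (b : β) (i : γ) (α α' : o) : blockOf X b i α α' = X (b, α) (i, α') := rfl

variable [Fintype β] [Fintype γ] [Fintype o] [DecidableEq β] [DecidableEq γ]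

omit [Fintype γ] [DecidableEq γ] in
/-- [folklore] Left site multiplication acts on the row blocks: `(siteMul v * X) (b,α) c = Σ_l v b α l · X (b,l) c`. -/
theorem siteMul_mul_apply (v : β → Matrix o o ℂ) (X : Matrix (β × o) (γ × o) ℂ) (b : β × o) (c : γ × o) :
    (siteMul v * X) b c = ∑ l : o, v b.1 b.2 l * X (b.1, l) c := by
  rw [Matrix.mul_apply, Fintype.sum_prod_type, Finset.sum_eq_single b.1]
  · exact Finset.sum_congr rfl fun l _ => by rw [siteMul_apply, if_pos rfl]
  · intro b' _ hb'
    exact Finset.sum_eq_zero fun l _ => by rw [siteMul_apply, if_neg (Ne.symm hb'), zero_mul]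
  · intro h; exact absurd (Finset.mem_univ _) h

omit [Fintype β] [DecidableEq β] in
/-- [folklore] Right site multiplication acts on the column blocks: `(X * siteMul w) b (i,α′) = Σ_l X b (i,l) · w i l α′`. -/
theorem mul_siteMul_apply (X : Matrix (β × o) (γ × o) ℂ) (w : γ → Matrix o o ℂ) (b : β × o) (c : γ × o) :
    (X * siteMul w) b c = ∑ l : o, X b (c.1, l) * w c.1 l c.2 := by
  rw [Matrix.mul_apply, Fintype.sum_prod_type, Finset.sum_eq_single c.1]
  · exact Finset.sum_congr rfl fun l _ => by rw [siteMul_apply, if_pos rfl]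
  · intro i' _ hi'
    exact Finset.sum_eq_zero fun l _ => by rw [siteMul_apply, if_neg hi', mul_zero]
  · intro h; exact absurd (Finset.mem_univ _) h

/-- [folklore] **THE ENTRY FORMULA**: `(siteMul v * X * siteMul w) (b,α) (i,α′) = (v b · X⟦b,i⟧ · w i) α α′`. -/
theorem siteMul_mul_mul_siteMul_apply (v : β → Matrix o o ℂ) (X : Matrix (β × o) (γ × o) ℂ) (w : γ → Matrix o o ℂ)
    (b : β × o) (c : γ × o) : (siteMul v * X * siteMul w) b c = (v b.1 * blockOf X b.1 c.1 * w c.1) b.2 c.2 := by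
  rw [mul_siteMul_apply, Matrix.mul_apply]
  refine Finset.sum_congr rfl fun l _ => ?_
  rw [siteMul_mul_apply, Matrix.mul_apply]
  rfl

/-- [folklore] The same formula read as an identity of blocks: `blockOf (siteMul v * X * siteMul w) b i = v b · blockOf X b i · w i`. -/
theorem blockOf_siteMul_mul_mul_siteMul (v : β → Matrix o o ℂ) (X : Matrix (β × o) (γ × o) ℂ) (w : γ → Matrix o o ℂ) (b : β) (i : γ) :
    blockOf (siteMul v * X * siteMul w) b i = v b * blockOf X b i * w i := by
  ext α α'
  rw [blockOf_apply, siteMul_mul_mul_siteMul_apply]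

omit [Fintype β] [Fintype γ] [DecidableEq β] [DecidableEq γ] [Fintype o] in
/-- [folklore] Matrices over site-colour products are determined by their blocks. -/
theorem ext_blockOf {X Y : Matrix (β × o) (γ × o) ℂ} (h : ∀ b i, blockOf X b i = blockOf Y b i) : X = Y := by
  ext ⟨b, α⟩ ⟨i, α'⟩
  have := congrFun (congrFun (h b i) α) α'
  simpa only [blockOf_apply] using this

end Blocks

/-! ## §2 Path contour systems -/

section PathSystem

variable {P : Params} {j : ℕ} {n : ℕ} [NeZero n] {M : Fin P.d → ℕ} [hM : ∀ μ, NeZero (M μ)]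

/-- [folklore] A contour system is a PATH SYSTEM (w.r.t. a chart `e` of the fine lattice and base points `base y` of the blocks) when
every contour `Γ y jj μ t` is a bond path from the block's base point to the source `bpt y jj + t·e_μ` of the averaged fine bond — the
SHAPE of [Balaban1984PropagatorsI] (1.7)∕(1.18) «Γ_{y,x} ∪ [x, x(b)]». -/
def IsPathSystem (e : Site P j ≃ Tor (fine n M)) (Γ : ContourSystem P.d n M) (base : Tor M → Site P j) : Prop :=
  ∀ (y : Tor M) (jj : Fin P.d → Fin n) (μ : Fin P.d) (t : ℕ),
    IsBondPath e (Γ y jj μ t) (base y) (e.symm (bpt n M y jj + tstep (fine n M) μ t))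

end PathSystem

/-! ## §3 The gauge law of the covariant block averaging of a gauge field -/

section GaugeLaw

variable {P : Params} {j : ℕ} {n : ℕ} [NeZero n] {M : Fin P.d → ℕ} [hM : ∀ μ, NeZero (M μ)]
variable {e : Site P j ≃ Tor (fine n M)} {Γ : ContourSystem P.d n M} {base : Tor M → Site P j}
variable {G : Type*} [GaugeGroup G] {o : Type*} [Fintype o] [DecidableEq o] (ι : G →* Matrix o o ℂ)

omit [NeZero n] hM in
/-- [folklore] THE BLOCK OF `Qcov`: at `((y, μ), (x, ν))` it is `0` unless `ν = μ`, and then the sum over the block positions `(jj, t)` with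
`x = bpt y jj + t·e_μ` of `n^{−(d+1)} · transport R μ (Γ y jj μ t)` (the definition, read blockwise). -/
theorem blockOf_Qcov (R : Fin P.d → (Tor (fine n M) × Fin P.d → Matrix o o ℂ)) (b : Tor M × Fin P.d) (i : Tor (fine n M) × Fin P.d) :
    blockOf (Qcov n M Γ R) b i =
      if i.2 = b.2 then
        ∑ jj : Fin P.d → Fin n, ∑ t : Fin n,
          (if i.1 = bpt n M b.1 jj + tstep (fine n M) b.2 t then (1 / (n : ℂ) ^ (P.d + 1)) • transport (fine n M) R b.2 (Γ b.1 jj b.2 t) else 0)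
      else 0 := by
  ext α α'
  rw [blockOf_apply, Qcov]
  split_ifs with h
  · rw [Matrix.sum_apply]
    refine Finset.sum_congr rfl fun jj _ => ?_
    rw [Matrix.sum_apply]
    refine Finset.sum_congr rfl fun t _ => ?_
    split_ifs
    · rw [Matrix.smul_apply, smul_eq_mul]
    · rfl
  · rfl

omit [NeZero n] hM in
/-- [folklore] **THE GAUGE LAW, BLOCKWISE**: along a path contour system, the block of `Q(U^u)` at `((y,μ),(x,ν))` is
`ι(u(base y)) · (block of Q(U)) · ι(u(e⁻¹x))⁻¹`. -/
theorem blockOf_Qcov_gaugeAct (hΓ : IsPathSystem e Γ base) (u : GaugeTransf P j G) (U : GaugeField P j G) (b : Tor M × Fin P.d)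
    (i : Tor (fine n M) × Fin P.d) :
    blockOf (Qcov n M Γ (transV e ι (GaugeField.gaugeAct u U))) b i =
      ι (u (base b.1)) * blockOf (Qcov n M Γ (transV e ι U)) b i * ι ((u (e.symm i.1))⁻¹) := by
  rw [blockOf_Qcov, blockOf_Qcov]
  split_ifs with h
  · rw [Finset.mul_sum, Finset.sum_mul]
    refine Finset.sum_congr rfl fun jj _ => ?_
    rw [Finset.mul_sum, Finset.sum_mul]
    refine Finset.sum_congr rfl fun t _ => ?_
    split_ifs with hx
    · rw [Matrix.mul_smul, Matrix.smul_mul, transport_transV_gaugeAct (hΓ b.1 jj b.2 t), ← hx]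
    · rw [Matrix.mul_zero, Matrix.zero_mul]
  · rw [Matrix.mul_zero, Matrix.zero_mul]

/-- [folklore] The COARSE gauge multiplier: `(y, μ) ↦ ι(u(base y))` on the unit-lattice vector index. -/
def coarseMul (base : Tor M → Site P j) (u : GaugeTransf P j G) : Tor M × Fin P.d → Matrix o o ℂ :=
  fun b => ι (u (base b.1))

omit [NeZero n] hM in
/-- [folklore] `coarseMul` unfolded. -/
@[simp] theorem coarseMul_apply (u : GaugeTransf P j G) (b : Tor M × Fin P.d) : coarseMul ι base u b = ι (u (base b.1)) := rfl

/-- [folklore] **`Q_k(U^u) = 𝒰_coarse · Q_k(U) · 𝒰_fine⁻¹`** — Bałaban's covariance of the covariant averaging ([Balaban1985BackgroundPropagators]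
(3.16)–(3.17) p. 393, SHAPE) for the V1 gauge field read through the dictionary, along ANY path contour system. -/
theorem Qcov_transV_gaugeAct (hΓ : IsPathSystem e Γ base) (u : GaugeTransf P j G) (U : GaugeField P j G) :
    Qcov n M Γ (transV e ι (GaugeField.gaugeAct u U)) =
      siteMul (coarseMul ι base u) * Qcov n M Γ (transV e ι U) * siteMul (gaugeMulInv e ι u) := by
  refine ext_blockOf fun b i => ?_
  rw [blockOf_siteMul_mul_mul_siteMul, blockOf_Qcov_gaugeAct ι hΓ, coarseMul_apply, gaugeMulInv_apply]

end GaugeLaw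

/-! ## §4 On the tower chart of record -/

section Tower

variable (P : Params) {G : Type*} [GaugeGroup G] {o : Type*} [Fintype o] [DecidableEq o] (ι : G →* Matrix o o ℂ)
variable {j k : ℕ} (h : j + k = P.K)

/-- [folklore] THE GAUGE LAW FOR `QcovOf`: on the tower chart `siteIdx P h`, for every path contour system (base points `base`),
`QcovOf P ι h Γ (U^u) = siteMul (coarse multiplier) * QcovOf P ι h Γ U * siteMul (gaugeMulInv (siteIdx P h) ι u)`. -/
theorem QcovOf_gaugeAct {Γ : ContourSystem P.d (lev P.L k) (unitMod P)} {base : Tor (unitMod P) → Site P j}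
    (hΓ : IsPathSystem (siteIdx P h) Γ base) (u : GaugeTransf P j G) (U : GaugeField P j G) :
    QcovOf P ι h Γ (GaugeField.gaugeAct u U) =
      siteMul (coarseMul ι base u) * QcovOf P ι h Γ U * siteMul (gaugeMulInv (siteIdx P h) ι u) :=
  Qcov_transV_gaugeAct ι hΓ u U

end Tower

end Summit.QuantumFields.BalabanUV.T4Continuum.SubstrateCovariantAveragingGauge

end
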